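import Summits.CriticalPhenomena.PercolationContinuityZ3.Theses.PercMinContact
import Literature.Probability.Percolation.TwoGhostInequalityProofs

/-!
# Route `PercMinContact`, item `LogMomentConverse` (stmt-CriticalPhenomena-11501) — part 3:
# the pathwise doubling bound on the number of swallows

Def-free helper lemmas for the proof of
`Summit.CriticalPhenomena.PercolationContinuityZ3.Theses.PercMinContact.LogMomentConverse`,
general vertex type `V`, graph `G` and root `o`. Fix a label field `U : Sym2 V → ℝ` (monotone
coupling, `configOfLabels t U G = {f ∈ E(G) | U f ≤ t}`) and a level `p_c`. A **swallow pair** is a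
pair `q = (b, y)` of adjacent vertices such that, writing `e = s(b, y)`, `τ = U e < p_c` and
`ω⁻ = configOfLabels τ U G \ {e}` (the configuration just before `e` opens), one has
`b ∈ C_{ω⁻}(o)`, `y ∉ C_{ω⁻}(o)` and `|C_{ω⁻}(o)| ≤ |C_{ω⁻}(y)|`: at level `τ` the edge `e` opens from
the cluster of the root onto a disjoint cluster at least as large (the cluster of `o` is "swallowed").

* `two_pow_card_le_encard_openCluster` (**doubling**): if the labels are injective, then for every
  finite set `s` of swallow pairs and every level `t` exceeding all their labels,
  `2 ^ |s| ≤ |C_{η_{<t}}(o)|`, `η_{<t} = {f ∈ E(G) | U f < t}` — each swallow at least doubles the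
  cluster of the root, and distinct swallow pairs have distinct labels (`Finset.induction_on_max_value`);
* `encard_swallowPairs_le_log` : consequently, if `C_{p_c}(o) := C_{configOfLabels p_c U G}(o)` is
  finite, the set of swallow pairs is finite and its cardinality `N_sw` satisfies
  `N_sw ≤ log(|C_{p_c}(o)| + 1) / log 2` (as an inequality in `ℝ≥0∞`);
* `tsum_sum_indicator_swallow_eq_encard` : `Σ'_b Σ_{y ∈ N(b)} 1{(b, y) swallow pair} = N_sw`.

This is the "each swallow at least doubles `|C(0)|` … `N_sw ≤ log₂|C_{p_c}(0)|` pathwise" step of the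
item's paper proof (card C3 of the route). References: the route's card C3; Grimmett 1999 §1.3
(monotone coupling).
-/

noncomputable section

namespace Summit.CriticalPhenomena.PercolationContinuityZ3.Theorems

namespace PercMinContactLMC

open MeasureTheory Literature.Probability.Percolation
open scoped ENNReal

variable {V : Type*}

/-! ### An elementary fact on clusters -/

/-- Opening an edge `e = s(b, y)` with `b ∈ C_ω(x)`: in any configuration `ω' ⊇ ω` containing `e`,
the cluster of `x` contains `C_ω(x) ∪ C_ω(y)`. [folklore] -/
theorem union_openCluster_subset {ω ω' : BondConfig V} (hsub : ω ⊆ ω') {b y x : V}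
    (hb : b ∈ openCluster ω x) (hby : b ≠ y) (he : s(b, y) ∈ ω') :
    openCluster ω x ∪ openCluster ω y ⊆ openCluster ω' x := by
  rintro z (hz | hz)
  · exact openCluster_mono hsub x hz
  · have hadj : (openGraph ω').Adj b y := (openGraph_adj ω' b y).2 ⟨he, hby⟩
    exact SimpleGraph.Reachable.trans (SimpleGraph.Reachable.trans (openCluster_mono hsub x hb)
      hadj.reachable) (openCluster_mono hsub y hz)

/-! ### The doubling induction -/

/-- **Doubling**: for injective labels, a finite set `s` of swallow pairs and a level `t` exceeding
all their labels, `2 ^ |s| ≤ |C_{η_{<t}}(o)|` where `η_{<t} = {f ∈ E(G) | U f < t}`. Induction on `s`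
along increasing labels (`Finset.induction_on_max_value`): the pair with the largest label `τ`
doubles the cluster of `o` between the levels `< τ` and `< t`, since just before `τ` the root's
cluster (which contains `C_{η_{<τ}}(o)`) is joined through `s(b, y)` to a disjoint cluster at least as
large; the other pairs have labels `< τ` (injectivity; the reversed pair `(y, b)` is not a swallow
pair). [folklore] -/
theorem two_pow_card_le_encard_openCluster [DecidableEq V] (G : SimpleGraph V) (o : V) (pc : ℝ)
    (U : Sym2 V → ℝ) (hU : Function.Injective U) (s : Finset (V × V))
    (hs : ∀ q ∈ s, G.Adj q.1 q.2 ∧ U s(q.1, q.2) < pc ∧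
      q.1 ∈ openCluster (configOfLabels (U s(q.1, q.2)) U G \ {s(q.1, q.2)}) o ∧
      q.2 ∉ openCluster (configOfLabels (U s(q.1, q.2)) U G \ {s(q.1, q.2)}) o ∧
      ((openCluster (configOfLabels (U s(q.1, q.2)) U G \ {s(q.1, q.2)}) o).encard : ℝ≥0∞) ≤
        (openCluster (configOfLabels (U s(q.1, q.2)) U G \ {s(q.1, q.2)}) q.2).encard)
    (t : ℝ) (ht : ∀ q ∈ s, U s(q.1, q.2) < t) :
    (2 : ℕ∞) ^ s.card ≤ (openCluster {f : Sym2 V | f ∈ G.edgeSet ∧ U f < t} o).encard := by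
  induction s using Finset.induction_on_max_value (f := fun q : V × V => U s(q.1, q.2))
    generalizing t with
  | empty =>
    rw [Finset.card_empty, pow_zero]
    exact Set.one_le_encard_iff_nonempty.2 ⟨o, mem_openCluster_self _ o⟩
  | insert a s ha hmax ih =>
    -- notation: `e` the edge of the top pair, `τ` its label, `ω⁻` the configuration just before `τ`
    obtain ⟨hadj, -, hb, hy, hle⟩ := hs a (Finset.mem_insert_self a s)
    have hτt : U s(a.1, a.2) < t := ht a (Finset.mem_insert_self a s)
    have hs' : ∀ q ∈ s, G.Adj q.1 q.2 ∧ U s(q.1, q.2) < pc ∧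
        q.1 ∈ openCluster (configOfLabels (U s(q.1, q.2)) U G \ {s(q.1, q.2)}) o ∧
        q.2 ∉ openCluster (configOfLabels (U s(q.1, q.2)) U G \ {s(q.1, q.2)}) o ∧
        ((openCluster (configOfLabels (U s(q.1, q.2)) U G \ {s(q.1, q.2)}) o).encard : ℝ≥0∞) ≤
          (openCluster (configOfLabels (U s(q.1, q.2)) U G \ {s(q.1, q.2)}) q.2).encard :=
      fun q hq => hs q (Finset.mem_insert_of_mem hq)
    -- the other pairs have strictly smaller labels
    have hlt : ∀ q ∈ s, U s(q.1, q.2) < U s(a.1, a.2) := by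
      intro q hq
      refine lt_of_le_of_ne (hmax q hq) fun heq => ?_
      have hqe : s(q.1, q.2) = s(a.1, a.2) := hU heq
      obtain ⟨-, -, hqb, hqy, -⟩ := hs' q hq
      rw [hqe] at hqb hqy
      rcases Sym2.eq_iff.1 hqe with ⟨h1, h2⟩ | ⟨h1, h2⟩
      · exact ha (by rwa [show q = a from Prod.ext h1 h2] at hq)
      · rw [h1] at hqb
        exact hy hqb
    have ih' := ih hs' (U s(a.1, a.2)) hlt
    -- the three configurations `η_{<τ} ⊆ ω⁻ ⊆ η_{<t}`
    have hsub1 : {f : Sym2 V | f ∈ G.edgeSet ∧ U f < U s(a.1, a.2)} ⊆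
        configOfLabels (U s(a.1, a.2)) U G \ {s(a.1, a.2)} := by
      rintro f ⟨hf, hfU⟩
      exact ⟨⟨hf, hfU.le⟩, fun hfe => hfU.ne (by rw [Set.mem_singleton_iff.1 hfe])⟩
    have hsub2 : configOfLabels (U s(a.1, a.2)) U G \ {s(a.1, a.2)} ⊆
        {f : Sym2 V | f ∈ G.edgeSet ∧ U f < t} := by
      rintro f ⟨⟨hf, hfU⟩, -⟩
      exact ⟨hf, hfU.trans_lt hτt⟩
    have he : s(a.1, a.2) ∈ {f : Sym2 V | f ∈ G.edgeSet ∧ U f < t} :=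
      ⟨(SimpleGraph.mem_edgeSet G).2 hadj, hτt⟩
    have hunion := union_openCluster_subset hsub2 hb hadj.ne he
    have hdisj := TwoGhost.disjoint_openCluster_of_not_mem hy
    have hle' : (openCluster (configOfLabels (U s(a.1, a.2)) U G \ {s(a.1, a.2)}) o).encard ≤
        (openCluster (configOfLabels (U s(a.1, a.2)) U G \ {s(a.1, a.2)}) a.2).encard := by
      exact_mod_cast hle
    rw [Finset.card_insert_of_notMem ha, pow_succ]
    calc (2 : ℕ∞) ^ s.card * 2
        ≤ (openCluster {f : Sym2 V | f ∈ G.edgeSet ∧ U f < U s(a.1, a.2)} o).encard * 2 := by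
          gcongr
      _ ≤ (openCluster (configOfLabels (U s(a.1, a.2)) U G \ {s(a.1, a.2)}) o).encard * 2 := by
          gcongr
          exact openCluster_mono hsub1 o
      _ = (openCluster (configOfLabels (U s(a.1, a.2)) U G \ {s(a.1, a.2)}) o).encard +
            (openCluster (configOfLabels (U s(a.1, a.2)) U G \ {s(a.1, a.2)}) o).encard := mul_two _
      _ ≤ (openCluster (configOfLabels (U s(a.1, a.2)) U G \ {s(a.1, a.2)}) o).encard +
            (openCluster (configOfLabels (U s(a.1, a.2)) U G \ {s(a.1, a.2)}) a.2).encard := by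
          gcongr
      _ = (openCluster (configOfLabels (U s(a.1, a.2)) U G \ {s(a.1, a.2)}) o ∪
            openCluster (configOfLabels (U s(a.1, a.2)) U G \ {s(a.1, a.2)}) a.2).encard :=
          (Set.encard_union_eq hdisj).symm
      _ ≤ (openCluster {f : Sym2 V | f ∈ G.edgeSet ∧ U f < t} o).encard := Set.encard_le_encard hunion

/-! ### Counting the swallow pairs -/

/-- **The swallow count is at most `log₂ |C_{p_c}(o)|`**: for injective labels, if the cluster of
`o` at level `p_c` is finite then the set of swallow pairs is finite, of cardinality `N_sw` with
`2 ^ N_sw ≤ |C_{p_c}(o)|`, whence `N_sw ≤ log(|C_{p_c}(o)| + 1) / log 2`. [folklore] -/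
theorem encard_swallowPairs_le_log [DecidableEq V] (G : SimpleGraph V) (o : V) (pc : ℝ)
    (U : Sym2 V → ℝ) (hU : Function.Injective U)
    (hfin : (openCluster (configOfLabels pc U G) o).Finite) :
    (({q : V × V | G.Adj q.1 q.2 ∧ U s(q.1, q.2) < pc ∧
        q.1 ∈ openCluster (configOfLabels (U s(q.1, q.2)) U G \ {s(q.1, q.2)}) o ∧
        q.2 ∉ openCluster (configOfLabels (U s(q.1, q.2)) U G \ {s(q.1, q.2)}) o ∧
        ((openCluster (configOfLabels (U s(q.1, q.2)) U G \ {s(q.1, q.2)}) o).encard : ℝ≥0∞) ≤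
          (openCluster (configOfLabels (U s(q.1, q.2)) U G \ {s(q.1, q.2)}) q.2).encard}).encard
        : ℝ≥0∞) ≤
      ENNReal.ofReal (Real.log ((openCluster (configOfLabels pc U G) o).ncard + 1) / Real.log 2) := by
  set SP : Set (V × V) := {q : V × V | G.Adj q.1 q.2 ∧ U s(q.1, q.2) < pc ∧
        q.1 ∈ openCluster (configOfLabels (U s(q.1, q.2)) U G \ {s(q.1, q.2)}) o ∧
        q.2 ∉ openCluster (configOfLabels (U s(q.1, q.2)) U G \ {s(q.1, q.2)}) o ∧
        ((openCluster (configOfLabels (U s(q.1, q.2)) U G \ {s(q.1, q.2)}) o).encard : ℝ≥0∞) ≤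
          (openCluster (configOfLabels (U s(q.1, q.2)) U G \ {s(q.1, q.2)}) q.2).encard} with hSP
  set n : ℕ := (openCluster (configOfLabels pc U G) o).ncard with hn
  -- every finite set of swallow pairs has at most `log₂ n` elements
  have hkey : ∀ F : Finset (V × V), ↑F ⊆ SP → 2 ^ F.card ≤ n := by
    intro F hF
    have h2 := two_pow_card_le_encard_openCluster G o pc U hU F (fun q hq => hF hq) pc
      (fun q hq => (hF hq).2.1)
    have hsub : {f : Sym2 V | f ∈ G.edgeSet ∧ U f < pc} ⊆ configOfLabels pc U G :=
      fun f hf => ⟨hf.1, hf.2.le⟩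
    have h3 := h2.trans (Set.encard_le_encard (openCluster_mono hsub o))
    rw [← hfin.cast_ncard_eq, ← hn] at h3
    exact_mod_cast h3
  -- hence the set of swallow pairs is finite
  have hSPfin : SP.Finite := by
    by_contra hinf
    obtain ⟨F, hF, hcard⟩ := Set.Infinite.exists_subset_card_eq hinf (n + 1)
    have h := hkey F hF
    rw [hcard] at h
    exact absurd (h.trans n.lt_two_pow_self.le) (not_le.2 (Nat.pow_lt_pow_right (by norm_num)
      (Nat.lt_succ_self n)))
  have hk := hkey hSPfin.toFinset (by simp)
  set k : ℕ := hSPfin.toFinset.card with hk'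
  rw [hSPfin.encard_eq_coe_toFinset_card, ← hk', ENat.toENNReal_coe, ← ENNReal.ofReal_natCast]
  refine ENNReal.ofReal_le_ofReal ?_
  rw [le_div_iff₀ (Real.log_pos one_lt_two), ← Real.log_pow]
  refine Real.log_le_log (by positivity) ?_
  have h : ((2 ^ k : ℕ) : ℝ) ≤ (n : ℝ) := Nat.cast_le.2 hk
  push_cast at h
  linarith

/-- **Sum form of the swallow count**: `Σ'_b Σ_{y ∈ N(b)} 1{(b, y) swallow pair} = N_sw`
(the `ℝ≥0∞`-cardinality of the set of swallow pairs). [folklore] -/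
theorem tsum_sum_indicator_swallow_eq_encard [DecidableEq V] (G : SimpleGraph V) [G.LocallyFinite]
    (o : V) (pc : ℝ) (U : Sym2 V → ℝ) :
    ∑' b, ∑ y ∈ G.neighborFinset b,
        {U : Sym2 V → ℝ | U s(b, y) < pc ∧ configOfLabels (U s(b, y)) U G \ {s(b, y)} ∈
          {ω : BondConfig V | b ∈ openCluster ω o ∧ y ∉ openCluster ω o ∧
            ((openCluster ω o).encard : ℝ≥0∞) ≤ (openCluster ω y).encard}}.indicator
          (fun _ => (1 : ℝ≥0∞)) U =
      (({q : V × V | G.Adj q.1 q.2 ∧ U s(q.1, q.2) < pc ∧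
        q.1 ∈ openCluster (configOfLabels (U s(q.1, q.2)) U G \ {s(q.1, q.2)}) o ∧
        q.2 ∉ openCluster (configOfLabels (U s(q.1, q.2)) U G \ {s(q.1, q.2)}) o ∧
        ((openCluster (configOfLabels (U s(q.1, q.2)) U G \ {s(q.1, q.2)}) o).encard : ℝ≥0∞) ≤
          (openCluster (configOfLabels (U s(q.1, q.2)) U G \ {s(q.1, q.2)}) q.2).encard}).encard
        : ℝ≥0∞) := by
  classical
  set SP : Set (V × V) := {q : V × V | G.Adj q.1 q.2 ∧ U s(q.1, q.2) < pc ∧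
        q.1 ∈ openCluster (configOfLabels (U s(q.1, q.2)) U G \ {s(q.1, q.2)}) o ∧
        q.2 ∉ openCluster (configOfLabels (U s(q.1, q.2)) U G \ {s(q.1, q.2)}) o ∧
        ((openCluster (configOfLabels (U s(q.1, q.2)) U G \ {s(q.1, q.2)}) o).encard : ℝ≥0∞) ≤
          (openCluster (configOfLabels (U s(q.1, q.2)) U G \ {s(q.1, q.2)}) q.2).encard} with hSP
  have hrow : ∀ b : V, ∑ y ∈ G.neighborFinset b,
      {U : Sym2 V → ℝ | U s(b, y) < pc ∧ configOfLabels (U s(b, y)) U G \ {s(b, y)} ∈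
        {ω : BondConfig V | b ∈ openCluster ω o ∧ y ∉ openCluster ω o ∧
          ((openCluster ω o).encard : ℝ≥0∞) ≤ (openCluster ω y).encard}}.indicator
        (fun _ => (1 : ℝ≥0∞)) U = ∑' y, SP.indicator (fun _ => (1 : ℝ≥0∞)) (b, y) := by
    intro b
    rw [sum_eq_tsum_indicator]
    refine tsum_congr fun y => ?_
    simp only [Set.indicator_apply, Finset.mem_coe, SimpleGraph.mem_neighborFinset, hSP,
      Set.mem_setOf_eq]
    by_cases hadj : G.Adj b y
    · simp only [hadj, true_and, if_true]
    · simp only [hadj, false_and, if_false]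
  simp_rw [hrow]
  rw [← ENNReal.tsum_prod, ← ENNReal.tsum_set_one, ← tsum_subtype SP fun _ => (1 : ℝ≥0∞)]

end PercMinContactLMC

end Summit.CriticalPhenomena.PercolationContinuityZ3.Theorems

end
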